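import Literature.Analysis.FluidPDE.TaoAveragedSymbolExtraction
import Literature.Analysis.FluidPDE.TaoAveragedSingleScaleAt
import HarnessLib

/-!
# Tao 2016, §3.5 with the base triple as a parameter: the Fourier side of `B_{η,ρ,0;ξ}` at the
# slots of a dilation-free datum, and (3.9) about `ξ` from the integrated tensor identity (3.13)

T. Tao, *Finite time blowup for an averaged three-dimensional Navier–Stokes equation*,
J. Amer. Math. Soc. **29** (2016), 601–674 = arXiv:1402.0290v3, §3.5 "Fifth step: extracting the
symbol", pp. 17–18. Sequel of `TaoAveragedSymbolExtraction.lean` (the same step at Tao's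
normalisation (3.7), `xi0`) with the base triple `ξ` of `TaoAveragedSingleScaleAt.lean` as a
parameter: the single-scale target is `B_{η,ρ,0;ξ}` (`betaRhoZeroFormAt ξ ε₀`, the `ρ`-cut-off
centred at `ξ 0`, the `η`-cut-off at the modulus ratios of `ξ`). HONEST FRAMING (cell
harvest/h2-tao-ladder, TAO-LADDER rung M_1 — MODEL statements about Tao's averaged equation): the
printed §3.5 reduction re-run with `ξ⁰ ↦ ξ` (Remark 3.5), as groundwork for the rung-1 crux
`SingleScaleNoDilAt` («L-1q uniform»: (3.9) at every closed base triangle); the reduction is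
PROVED here, the tensor identity (3.13) about `ξ` is NOT asserted (it is the crux) — it appears only
as the hypothesis of `singleScaleAt_isComplexAverageNoDil_of_tensorIdentityAt`. Nothing here
concerns the true Navier–Stokes equations.

* `ComplexAveragingDatum.freqSideIntegrandAt ξ ε₀` — the `ω`-integrand of the right-hand side of
  (3.9) about `ξ` on the Fourier side:
  `∫_{ζ₁+ζ₂+ζ₃=0} φ(|ζ₁-ξ 0|/ε₀²) η_ξ(|ζ₁|,|ζ₂|,|ζ₃|) Λ(m₁(ζ₁)R₁X₁(R₁⁻¹ζ₁), m₂(ζ₂)R₂X₂(R₂⁻¹ζ₂), m₃(ζ₃)R₃X₃(R₃⁻¹ζ₃))`;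
* `ComplexAveragingDatum.betaRhoZeroFormAt_slot` — for a dilation-free datum,
  `⟨B_{η,ρ,0;ξ}(m₁(D)Rot u, m₂(D)Rot v), m₃(D)Rot w⟩ = freqSideIntegrandAt ξ ε₀ θ û v̂ ŵ`;
* `singleScaleAt_isComplexAverageNoDil_of_tensorIdentityAt` — **(3.9) about `ξ` from the integrated
  tensor identity (3.13) about `ξ`** (Plancherel for the factors of `C₀`, `pairing_conjL2_schwartz`).

## References

* T. Tao, J. Amer. Math. Soc. 29 (2016), 601–674, arXiv:1402.0290v3, §3.4 (3.8)–(3.9), §3.5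
  pp. 17–18 ((3.12)–(3.13)), Remark 3.5 p. 20. Key `Tao2016AveragedNS`.
-/

noncomputable section

open MeasureTheory Set Filter FourierTransform
open scoped ENNReal NNReal SchwartzMap ComplexConjugate InnerProductSpace

namespace Literature.Analysis.FluidPDE.Tao2016

/-- Local notation for physical / frequency space `ℝ³`. -/
local notation "ℝ³" => EuclideanSpace ℝ (Fin 3)
/-- Local notation for the complexified range `ℂ³`. -/
local notation "ℂ³" => EuclideanSpace ℂ (Fin 3)

namespace ComplexAveragingDatum

variable (𝒟 : ComplexAveragingDatum)

/-- **The `ω`-integrand of the right-hand side of (3.9) about `ξ` on the Fourier side** (§3.5, the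
display after "Meanwhile, the right-hand side of (3.9) can be expanded as", with `ξ⁰ ↦ ξ`):
`∫_{ζ₁+ζ₂+ζ₃=0} φ(|ζ₁-ξ 0|/ε₀²) η_ξ(|ζ₁|,|ζ₂|,|ζ₃|) Λ_{ζ₁,ζ₂,ζ₃}(m_{1,ω}(ζ₁) R_{1,ω} X₁(R_{1,ω}⁻¹ζ₁), …)`
(Bochner junk `0`; the tree's `freqSideIntegrand` is the `xi0` instance). [cite: Tao2016AveragedNS, §3.5 p. 17] -/
def freqSideIntegrandAt (ξ : Fin 3 → ℝ³) (ε₀ : ℝ) (θ : 𝒟.Ω) (X₁ X₂ X₃ : ℝ³ → ℂ³) : ℂ :=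
  ∫ p : ℝ³ × ℝ³,
    ((freqCutoff (‖p.1 - ξ 0‖ / ε₀ ^ 2) * etaAt ξ ε₀ ‖p.1‖ ‖p.2‖ ‖-p.1 - p.2‖ : ℝ) : ℂ) *
      Λ p.1 p.2 (𝒟.slotFreq 0 θ X₁ p.1) (𝒟.slotFreq 1 θ X₂ p.2) (𝒟.slotFreq 2 θ X₃ (-p.1 - p.2))

/-- At `ξ = xi0` the parametrised integrand is the tree's `freqSideIntegrand` (by `rfl`, `etaAt_xi0`).
[cite: Tao2016AveragedNS, §3.5 p. 17] -/
theorem freqSideIntegrandAt_xi0 (ε₀ : ℝ) (θ : 𝒟.Ω) (X₁ X₂ X₃ : ℝ³ → ℂ³) :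
    𝒟.freqSideIntegrandAt xi0 ε₀ θ X₁ X₂ X₃ = 𝒟.freqSideIntegrand ε₀ θ X₁ X₂ X₃ := rfl

/-- **The Fourier side of the right-hand side of (3.9) about `ξ`** (§3.5 with `ξ⁰ ↦ ξ`): for a
dilation-free complex averaging datum and every `ω`,
`⟨B_{η,ρ,0;ξ}(m_{1,ω}(D) Rot_{R_{1,ω}} u, m_{2,ω}(D) Rot_{R_{2,ω}} v), m_{3,ω}(D) Rot_{R_{3,ω}} w⟩`
equals the frequency-side integrand about `ξ` at `(û, v̂, ŵ)`. [cite: Tao2016AveragedNS, §3.5 p. 17] -/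
theorem betaRhoZeroFormAt_slot (hlam : ∀ i θ, 𝒟.lam i θ = 1) (ξ : Fin 3 → ℝ³) (ε₀ : ℝ) (θ : 𝒟.Ω)
    (u v w : L2C) :
    betaRhoZeroFormAt ξ ε₀ (𝒟.slot 0 θ u) (𝒟.slot 1 θ v) (𝒟.slot 2 θ w) =
      𝒟.freqSideIntegrandAt ξ ε₀ θ (fourierFn u) (fourierFn v) (fourierFn w) := by
  unfold betaRhoZeroFormAt freqSideIntegrandAt
  refine integral_congr_ae ?_
  have h0 : ∀ᵐ ζ ∂(volume : Measure ℝ³), ζ ∈ ({0}ᶜ : Set ℝ³) :=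
    compl_mem_ae_iff.mpr (measure_singleton _)
  have q1 := Measure.quasiMeasurePreserving_fst (μ := (volume : Measure ℝ³))
    (ν := (volume : Measure ℝ³))
  have q2 := Measure.quasiMeasurePreserving_snd (μ := (volume : Measure ℝ³))
    (ν := (volume : Measure ℝ³))
  have q3 := quasiMeasurePreserving_neg_fst_sub_snd
  rw [Measure.volume_eq_prod]
  filter_upwards [q1.ae_eq (𝒟.fourierFn_slot_ae_eq_of_lam hlam 0 θ u),
    q2.ae_eq (𝒟.fourierFn_slot_ae_eq_of_lam hlam 1 θ v),
    q3.ae_eq (𝒟.fourierFn_slot_ae_eq_of_lam hlam 2 θ w), q1.ae h0, q2.ae h0, q3.ae h0]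
    with p e1 e2 e3 n1 n2 n3
  simp only [Function.comp_apply] at e1 e2 e3
  rw [e1, e2, e3, Set.indicator_of_mem n1, Set.indicator_of_mem n2, Set.indicator_of_mem n3]
  rfl

end ComplexAveragingDatum

/-! ### (3.9) about `ξ` from (3.13) about `ξ` -/

/-- **Tao 2016, §3.5 with `ξ⁰ ↦ ξ`: the single-scale representation (3.9) about `ξ` follows from the
rotation-averaging identity (3.13) about `ξ` in integrated form** — if a dilation-free complex
averaging datum `𝒟` satisfies
`∫_Ω freqSideIntegrandAt ξ ε₀ ω (û, v̂, ŵ) dμ(ω) = ∏ⱼ ∫ X̂ⱼ · \overline{ψ̂ⱼ}` for all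
`u, v, w ∈ H¹⁰_df ⊗ ℂ`, then `C₀ = ⟨u,ψ̄₁⟩⟨v,ψ̄₂⟩⟨w,ψ̄₃⟩` is a dilation-free complex average of
`B_{η,ρ,0;ξ}` over `𝒟` (Plancherel `pairing_conjL2_schwartz` on the left, `betaRhoZeroFormAt_slot`
on the right). The hypothesis (the tensor identity about `ξ`) is proved in the source only at
`ξ = xi0` (§3.6–§3.9); it is NOT asserted here. [cite: Tao2016AveragedNS, §3.5 pp. 17–18 and Remark 3.5 p. 20] -/
theorem singleScaleAt_isComplexAverageNoDil_of_tensorIdentityAt (ξ : Fin 3 → ℝ³) (ε₀ : ℝ)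
    (ψ : Fin 3 → 𝓢(ℝ³, ℂ³)) (𝒟 : ComplexAveragingDatum) (hlam : ∀ i θ, 𝒟.lam i θ = 1)
    (h𝒟 : ∀ u v w : L2C, MemH10dfC u → MemH10dfC v → MemH10dfC w →
      ∫ θ, 𝒟.freqSideIntegrandAt ξ ε₀ θ (fourierFn u) (fourierFn v) (fourierFn w) ∂𝒟.μ =
        (∫ ζ, cdot (fourierFn u ζ) (conj3 (𝓕 (⇑(ψ 0)) ζ))) *
          (∫ ζ, cdot (fourierFn v ζ) (conj3 (𝓕 (⇑(ψ 1)) ζ))) *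
            ∫ ζ, cdot (fourierFn w ζ) (conj3 (𝓕 (⇑(ψ 2)) ζ))) :
    IsComplexAverageNoDilOf (singleScaleForm (ψ 0) (ψ 1) (ψ 2)) (betaRhoZeroFormAt ξ ε₀) := by
  refine ⟨𝒟, hlam, fun u v w hu hv hw => ?_⟩
  unfold singleScaleForm ComplexAveragingDatum.average
  rw [pairing_conjL2_schwartz, pairing_conjL2_schwartz, pairing_conjL2_schwartz,
    ← h𝒟 u v w hu hv hw]
  refine integral_congr_ae (Eventually.of_forall fun θ => ?_)
  exact (𝒟.betaRhoZeroFormAt_slot hlam ξ ε₀ θ u v w).symm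

end Literature.Analysis.FluidPDE.Tao2016
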